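import Literature.Barriers.CriticalPhenomena.AmenableInvariantPercolation
import Literature.Barriers.CriticalPhenomena.SubexponentialGrowthZd
import Mathlib.Analysis.SpecialFunctions.Pow.Real
import HarnessLib

/-!
# Finite-volume two-arm estimates: the annulus-crossing event `Piv[m, n]`, Easo–Hutchcroft 2023 Prop. 2.1 and Lemma 2.3 (a priori uniqueness zone)

Statement-only Literature file: TWO vocabulary definitions (`graphSphere`, `Piv`) and TWO named facts, proved in print, NOT proved here (net debt +2).
Source: P. Easo, T. Hutchcroft, *The critical percolation probability is local*, arXiv:2310.10983 (2023) [EasoHutchcroft2023], §2.1 «Aizenman–Kesten–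
Newman and the a priori uniqueness zone», pp. 16–17, read verbatim:

* (p. 16) «Given `m, n ∈ (0, ∞)` with `m ≤ n`, we define `Piv[m, n]` to be the event that there exist two distinct clusters in `ω ∩ B_n` that each intersect
  both spheres `S_n` and `S_m`.  (That is, `Piv[m, n]` is the event that there is more than one cluster crossing the annulus from `m` to `n`.)»  Here `B_n`
  is the graph-distance ball of radius `n` around the root `o` and `S_n` the set of vertices at distance exactly `n` (p. 9); `Gr(n) := |B_n(o)|` (p. 6).
* **Proposition 2.1** (p. 16; «a minor variation on [CMT22, Proposition 4.1]»): «For each `0 < ε < 1/2`, `0 < η < 1`, and `d ≥ 1` there exists a constant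
  `C = C(ε, η, d)` such that if `G` is a connected, transitive graph of vertex degree `d` then `P_p(Piv[1, n]) ≤ C (log Gr(n)/n)^{1/2 − ε}` for every
  `p ∈ [η, 1]` and `n ≥ 1`.»  The constant is UNIFORM over all such graphs (the quantifier order is the content).
* **Lemma 2.3** (p. 17; «[CMT22, Lemma 6.2]», essentially Cerf 2015): «Let `G` be a connected transitive graph.  Then
  `P_p(Piv[r, n]) ≤ P_p(Piv[1, n/2]) · |S_r|² · Gr(m) / min_{a,b ∈ S_r} P_p(a ↔_{B_m} b)` (6) for every `r, m, n ∈ (1, ∞)` with `r ≤ m ≤ n/2` and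
  every `p ∈ (0, 1)`.»  Remark 2.1 (same page): `B_m`, NOT `B_{2m}` (the CMT printing is a typo per EH).

TYPED FORM (tree vocabulary: `graphBall` / `ballVolume` «SubexponentialGrowthZd», `openConnIn` / `bondPercolation` «Percolation», `IsGraphTransitive`
«AmenableInvariantPercolation»; «transitive» = vertex-transitive).  `Piv` is typed WITHOUT a cluster object: two vertices `x, y` each joined INSIDE `B_n`
to `S_m` and to `S_n`, and NOT joined to each other inside `B_n` (⟺ two distinct clusters of `ω ∩ B_n` each meeting both spheres).  Radii are NATURAL
numbers: Prop. 2.1 is printed with `n ≥ 1`; Lemma 2.3 is typed with `n/2 ↦ ⌊n/2⌋` — the SAFE direction, since `Piv[1, ·]` is decreasing in the outer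
radius (two distinct crossing clusters of `ω ∩ B_n` restrict to two of `ω ∩ B_{n'}`, `n' ≤ n`), so the typed form is implied by the printed one; and the
division by `min_{a,b ∈ S_r}` is MULTIPLIED OUT against any uniform lower bound `q ≤ P_p(a ↔_{B_m} b)` (`a, b ∈ S_r`) — equivalent to (6) when `S_r ≠ ∅`
(the min is `> 0`: geodesics), vacuously true when `S_r = ∅`; no `min` over a possibly empty set, no division.
-- TODO(general form): real radii `r, m, n ∈ (1, ∞)` with EH's conventions for `B_x`, `S_x`.
NOT typed (by design, lane ruling): Lemma 2.2 (internal to the proof of 2.1) and Corollary 2.4 (its zone constants are not uniform in a growth RATE).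
Consumers: the lane `prim-bschramm`'s D12 line (T6 «uniquenessZone_gzCay»: Prop. 2.1 + Lemma 2.3 + a growth upper rate ⇒ the a priori uniqueness zone on
`Cay(𝔊 × ℤ)`); the in-ball connection is LITERALLY `(bondPercolation G p).real (openConnIn (graphBall G o R) a b)`, as in the Summits-side `connIn`.
[cite: EasoHutchcroft2023, §2.1 pp. 16–17 (Prop. 2.1, Lemma 2.3, Remark 2.1)] [cite: ContrerasMartineauTassion2024, Prop. 4.1, Lemma 6.2] [cite: Cerf2015, §5]
-/

namespace Literature.Probability.Percolation

open Literature.Barriers.CriticalPhenomena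

variable {V : Type*}

/-! ## Vocabulary: spheres and the annulus-crossing event -/

/-- **The sphere `S_n(o)`**: the vertices at graph distance EXACTLY `n` from `o` — in the ball of radius `n` and in no smaller ball (EH p. 9: «we write
`S_n` for the set of vertices at distance exactly `n` from `o`»). [cite: EasoHutchcroft2023, §1 p. 9 (notation B_n, S_n)] -/
def graphSphere (G : SimpleGraph V) (o : V) (n : ℕ) : Set V :=
  {y | y ∈ graphBall G o n ∧ ∀ k : ℕ, k < n → y ∉ graphBall G o k}

/-- **The annulus-crossing event `Piv[m, n]` around `o`** (EH p. 16): «there exist two distinct clusters in `ω ∩ B_n` that each intersect both spheres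
`S_n` and `S_m`» — typed without a cluster object as: there are vertices `x`, `y`, EACH joined by an `ω`-open path INSIDE `B_n(o)` to some vertex of
`S_m(o)` and to some vertex of `S_n(o)`, and NOT joined to each other inside `B_n(o)` (so their clusters in `ω ∩ B_n` are distinct and both cross the
annulus).  Intended for `m ≤ n`. [cite: EasoHutchcroft2023, §2.1 p. 16 (definition of Piv[m, n])] -/
def Piv (G : SimpleGraph V) (o : V) (m n : ℕ) : Set (BondConfig V) :=
  {ω | ∃ x y : V,
    (∃ s ∈ graphSphere G o m, ω ∈ openConnIn (graphBall G o n) x s) ∧ (∃ t ∈ graphSphere G o n, ω ∈ openConnIn (graphBall G o n) x t) ∧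
    (∃ s ∈ graphSphere G o m, ω ∈ openConnIn (graphBall G o n) y s) ∧ (∃ t ∈ graphSphere G o n, ω ∈ openConnIn (graphBall G o n) y t) ∧
    ω ∉ openConnIn (graphBall G o n) x y}

/-! ## The two printed facts (NAMED FACTS — proved in print, not in the tree) -/

/-- **Easo–Hutchcroft 2023, Proposition 2.1 (finite-volume two-arm estimate; a minor variation on CMT Prop. 4.1).**  «For each `0 < ε < 1/2`,
`0 < η < 1`, and `d ≥ 1` there exists a constant `C = C(ε, η, d)` such that if `G` is a connected, transitive graph of vertex degree `d` then
`P_p(Piv[1, n]) ≤ C (log Gr(n)/n)^{1/2 − ε}` for every `p ∈ [η, 1]` and `n ≥ 1`.»  `C` is UNIFORM over all connected vertex-transitive `d`-regular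
graphs; `Gr(n) = |B_n(o)|` is the tree's `ballVolume G o n`. [cite: EasoHutchcroft2023, Prop. 2.1 p. 16] [cite: ContrerasMartineauTassion2024, Prop. 4.1] -/
def EasoHutchcroft2023_prop_2_1 : Prop :=
  ∀ (ε η : ℝ) (d : ℕ), 0 < ε → ε < 1 / 2 → 0 < η → η < 1 → 1 ≤ d →
    ∃ C : ℝ, ∀ {W : Type} (G : SimpleGraph W) [G.LocallyFinite] (o : W),
      G.Connected → IsGraphTransitive G → (∀ v : W, G.degree v = d) →
      ∀ (p : unitInterval) (n : ℕ), η ≤ (p : ℝ) → 1 ≤ n →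
        (bondPercolation G p).real (Piv G o 1 n) ≤ C * (Real.log (ballVolume G o n) / n) ^ (1 / 2 - ε)

/-- **Easo–Hutchcroft 2023, Lemma 2.3 (= CMT Lemma 6.2; essentially Cerf 2015) — the a priori uniqueness zone's input.**  «Let `G` be a connected
transitive graph.  Then `P_p(Piv[r, n]) ≤ P_p(Piv[1, n/2]) · |S_r|² · Gr(m) / min_{a,b ∈ S_r} P_p(a ↔_{B_m} b)` for every `r, m, n ∈ (1, ∞)` with
`r ≤ m ≤ n/2` and every `p ∈ (0, 1)`» (with `B_m`, Remark 2.1).  TYPED INSTANCE: natural radii `2 ≤ r ≤ m ≤ ⌊n/2⌋`, `n/2 ↦ ⌊n/2⌋` (implied by the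
printed form, `Piv[1, ·]` being decreasing in the outer radius), and the quotient multiplied out against ANY uniform lower bound `q` of the in-ball
connection probabilities on `S_r` (⟺ (6) when `S_r ≠ ∅`, vacuous otherwise).
-- TODO(general form): real radii in `(1, ∞)`.
[cite: EasoHutchcroft2023, Lemma 2.3 p. 17, Remark 2.1] [cite: ContrerasMartineauTassion2024, Lemma 6.2] [cite: Cerf2015, §5] -/
def EasoHutchcroft2023_lemma_2_3 : Prop :=
  ∀ {W : Type} (G : SimpleGraph W) [G.LocallyFinite] (o : W),
    G.Connected → IsGraphTransitive G →
    ∀ (p : unitInterval) (r m n : ℕ) (q : ℝ),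
      0 < (p : ℝ) → (p : ℝ) < 1 → 2 ≤ r → r ≤ m → m ≤ n / 2 → 0 < q →
      (∀ a ∈ graphSphere G o r, ∀ b ∈ graphSphere G o r, q ≤ (bondPercolation G p).real (openConnIn (graphBall G o m) a b)) →
        q * (bondPercolation G p).real (Piv G o r n) ≤
          (bondPercolation G p).real (Piv G o 1 (n / 2)) * ((graphSphere G o r).ncard : ℝ) ^ 2 * (ballVolume G o m : ℝ)

end Literature.Probability.Percolation
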